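import Literature.NumberTheory.GaloisCohomology.Howard2004.DVRSettingEngineChebIIProofs
import HarnessLib

/-!
# Howard 2004, Lemma 1.6.4 on a `DVRSetting`: the Čebotarev binders `hchebI` / `hchebII` in the ENGINE's own currency
# (`H k n = ↥(S.selmerModuleAt hy k n)`, `loc = locR.domRestrict`, the `ρ±` letters of `DVRSettingEngineRhoProofs`)

Topic `NumberTheory/GaloisCohomology/Howard2004` (sequel to `DVRSettingEngineChebProofs` (`exists_enginePrime_caseI`) and
`DVRSettingEngineChebIIProofs` (`exists_enginePrime_caseII`), which state the two binders on the underlying classes).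
THEOREMS ONLY: no definition, no named fact, no instance, no notation, no `sorry`.

B. Howard, *The Heegner point Kolyvagin system*, Compositio Math. 140 (2004) = arXiv:1202.6340, Lemma 1.6.4 (p. 11 L82 –
p. 12 L27).  The engine `DVRSettingEngineData.mem_stub_of_stubLemmaInduction_levels'` /
`DVRSettingEngineRedProofs.mem_stub_of_stubLemmaInduction_levels_guarded` is instantiated (seat x10b-p1-w2 g16,
`DVRSettingEngineAssemblyFull` / `…Residual`) at `H k n := ↥(S.selmerModuleAt hy k n)`,
`loc k n ℓ := (S.locR k (Sum.inr ℓ)).domRestrict (S.selmerModuleAt hy k n)`, `P := S.enginePrimes`, `ϖ := S.π`, with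
`ℕ`-valued eigen-lengths `ρp ρm` — `(ρp k n : ℕ∞) = length_{R_k} (Sel_{F̄_k(n)} ⊓ ker(τ_* − id))` for `n ⊆ 𝓛^{(2k-1)}`, the letters
of `DVRSettingEngineRhoProofs.exists_eigenLengths` (seat x10b-p1-w8 g11) up to the stability WITNESS inside
`submoduleOfStable`: here, as in `exists_enginePrime_caseI/II`, the witness is the term
`scalarMapH1_mem_inf … (S.scalarMapH1_mem_residualSelmer_modify hy k ∅ ∅ n) (S.scalarMapH1_mem_kerSub hy k)`; w8's letters
carry `S.scalarMapH1_mem_residualSelmer_inf_ker_sub hy k ∅ ∅ n` — the SAME submodule (proof irrelevance), so a consumer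
holding w8's `hρp` passes `fun k n hn => (hρp k n hn).trans rfl` (do not restate the letter with that witness under a
`∀ k`: the elaborator then diverges, whnf timeout).  This file rewrites `exists_enginePrime_caseI/II` in the engine's
currency, everything quantified over `(k, n ⊆ 𝓛^{(2k-1)}, ℓ ∈ 𝓛^{(2k-1)} ∖ n)`; the Lemma 1.5.3 Galois letters (`hdis`,
`hGD^±`, `hor^±`) stay binders.

* **`engine_hchebI`**, **`engine_hchebII`**.

Cell `pub/bsd-print-x9`, G87 = Howard Thm. 1.6.1 (print leaf `stub_h161` of stmt-BirchSwinnertonDyer-22642); seat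
`bsd-line-x10b-p1-w6` g9, brick (ENGINE-hcheb) part 2e.  `thm161_dvrKolyvaginBound` is NOT proved; BSD is not proved by
any of this.

References: [Howard2004HeegnerKolyvagin] Lemma 1.6.4.
-/

set_option autoImplicit false

noncomputable section

open Function NumberField IsDedekindDomain Field
open scoped NumberField ContRepresentation Classical

namespace Literature.NumberTheory.GaloisCohomology.Howard2004

open Literature.NumberTheory.GaloisRepresentations
open Literature.NumberTheory.GaloisRepresentations.DiscreteGaloisModule
open Literature.NumberTheory.EllipticCurves

namespace DVRSetting

variable {p : ℕ} [Fact p.Prime] {K : Type} [Field K] [NumberField K]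
  {R : Type} [CommRing R] [IsDomain R] [IsDiscreteValuationRing R] [Algebra ℤ_[p] R]
  {N : ℕ → Type} [∀ k, AddCommGroup (N k)] [∀ k, TopologicalSpace (N k)]
  [∀ k, DiscreteTopology (N k)] [∀ k, Module R (N k)]
  {Rk : ℕ → Type} [∀ k, CommRing (Rk k)] [∀ k, IsLocalRing (Rk k)] [∀ k, TopologicalSpace (Rk k)]
  [∀ k, DiscreteTopology (Rk k)] [∀ k, Algebra ℤ_[p] (Rk k)] [∀ k, Algebra R (Rk k)]
  [∀ k, Module (Rk k) (N k)] [∀ k, IsScalarTower R (Rk k) (N k)]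
  {Nbar : Type} [AddCommGroup Nbar] [TopologicalSpace Nbar] [DiscreteTopology Nbar]
  [∀ k, Module (Rk k) Nbar]
  {Nq : ℕ → Finset (HeightOneSpectrum (𝓞 K)) → Type} [∀ k n, AddCommGroup (Nq k n)]
  [∀ k n, TopologicalSpace (Nq k n)] [∀ k n, DiscreteTopology (Nq k n)]
  [∀ k n, Module (Rk k) (Nq k n)] [∀ k n, Module R (Nq k n)]
  [∀ k n, IsScalarTower R (Rk k) (Nq k n)]

/-! ## The two binders in the ENGINE's own currency (`H k n = ↥(S.selmerModuleAt hy k n)`, `loc = locR.domRestrict`,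
`ρ±` letters of `DVRSettingEngineRhoProofs.exists_eigenLengths`) -/

-- the statement alone (eight `Module.length` letters under `∀ k`, plus the `selmerModuleAt` currency) costs ≈ 250k
-- heartbeats to elaborate; the proof is a repackaging of `exists_enginePrime_caseI`.
set_option maxHeartbeats 800000 in
/-- **The engine binder `hchebI` VERBATIM** (`DVRSettingEngineData.mem_stub_of_stubLemmaInduction_levels'` /
`…RedProofs.…_guarded` at `H k n := ↥(S.selmerModuleAt hy k n)`, `loc k n ℓ := (S.locR k (Sum.inr ℓ)).domRestrict _`,
`P := S.enginePrimes`, `ϖ := S.π`), for `ℕ`-valued eigen-length letters `ρp ρm` (the lengths of `Sel_{F̄_k(n)} ⊓ ker(τ_* ∓ id)` over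
`R_k`, cf. `DVRSettingEngineRhoProofs.exists_eigenLengths`) and the Lemma 1.5.3 Galois letters `hdis`, `hGD^±`, `hor^±` at
every `(k, n ⊆ 𝓛^{(2k-1)}, ℓ ∈ 𝓛^{(2k-1)} ∖ n)`. [cite: Howard2004HeegnerKolyvagin, Lemma 1.6.4, Case i (arXiv:1202.6340 p. 12 L1–14)] -/
theorem engine_hchebI [Finite Nbar] [∀ k, Finite (N k)]
    (S : DVRSetting p K R N Rk Nbar Nq) (hy : S.SatisfiesH) (hC : Automorphic.chebotarev_artinRep)
    (hp0 : ((p : ℕ) : R) ≠ 0) (hL : S.LargePrimes)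
    (ρp ρm : ℕ → Finset (HeightOneSpectrum (𝓞 K)) → ℕ)
    (hρp : ∀ (k : ℕ) (n : Finset (HeightOneSpectrum (𝓞 K))), ↑n ⊆ S.enginePrimes k →
      letI := galoisCohomology.moduleH1 S.ρbar (S.isScalarLinear_rhobar hy k);
      ((ρp k n : ℕ) : ℕ∞) = Module.length (Rk k) ↥(galoisCohomology.submoduleOfStable (S.isScalarLinear_rhobar hy k)
        ((((hy.h1 k).1.propagateStructure (S.t k).cond).modify (transverseStructure p S.ρbar S.jbar) ∅ ∅ n).selmerGroup ⊓
          ((semilinearH S.cd.isLift (S.A k).θ.toAddMonoidHom (S.A k).isSemilinear 1) - AddMonoidHom.id _).ker)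
        (scalarMapH1_mem_inf S.ρbar (S.isScalarLinear_rhobar hy k) (S.scalarMapH1_mem_residualSelmer_modify hy k ∅ ∅ n)
          (S.scalarMapH1_mem_kerSub hy k))))
    (hρm : ∀ (k : ℕ) (n : Finset (HeightOneSpectrum (𝓞 K))), ↑n ⊆ S.enginePrimes k →
      letI := galoisCohomology.moduleH1 S.ρbar (S.isScalarLinear_rhobar hy k);
      ((ρm k n : ℕ) : ℕ∞) = Module.length (Rk k) ↥(galoisCohomology.submoduleOfStable (S.isScalarLinear_rhobar hy k)
        ((((hy.h1 k).1.propagateStructure (S.t k).cond).modify (transverseStructure p S.ρbar S.jbar) ∅ ∅ n).selmerGroup ⊓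
          ((semilinearH S.cd.isLift (S.A k).θ.toAddMonoidHom (S.A k).isSemilinear 1) + AddMonoidHom.id _).ker)
        (scalarMapH1_mem_inf S.ρbar (S.isScalarLinear_rhobar hy k) (S.scalarMapH1_mem_residualSelmer_modify hy k ∅ ∅ n)
          (S.scalarMapH1_mem_kerAdd hy k))))
    (hdis : ∀ (k : ℕ), ∀ v ∈ S.enginePrimes k,
      Disjoint (((hy.h1 k).1.propagateStructure (S.t k).cond) (Sum.inr v))
        ((transverseStructure p S.ρbar S.jbar) (Sum.inr v)))
    (hGDp : ∀ (k : ℕ) (n : Finset (HeightOneSpectrum (𝓞 K))), ↑n ⊆ S.enginePrimes k →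
      ∀ v ∈ S.enginePrimes k, v ∉ n →
      letI := (galoisCohomology.moduleH1 (S.ρbar.toLocal (Sum.inr v))
        ((S.isScalarLinear_rhobar hy k).restrictField (Place.Completion (Sum.inr v))));
      Module.length (Rk k) ↥(galoisCohomology.submoduleOfStable
        ((S.isScalarLinear_rhobar hy k).restrictField (Place.Completion (Sum.inr v)))
        (((((hy.h1 k).1.propagateStructure (S.t k).cond).modify (transverseStructure p S.ρbar S.jbar) {v} ∅ n).selmerGroup ⊓
          ((semilinearH S.cd.isLift (S.A k).θ.toAddMonoidHom (S.A k).isSemilinear 1) - AddMonoidHom.id _).ker).map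
          (galoisCohomology.localization S.ρbar (Sum.inr v) 1))
        (scalarMapH1_mem_map_localization S.ρbar (S.isScalarLinear_rhobar hy k) (Sum.inr v)
          (scalarMapH1_mem_inf S.ρbar (S.isScalarLinear_rhobar hy k) (S.scalarMapH1_mem_residualSelmer_modify hy k {v} ∅ n)
          (S.scalarMapH1_mem_kerSub hy k)))) = 1)
    (horp : ∀ (k : ℕ) (n : Finset (HeightOneSpectrum (𝓞 K))), ↑n ⊆ S.enginePrimes k →
      ∀ v ∈ S.enginePrimes k, v ∉ n →
      ((((hy.h1 k).1.propagateStructure (S.t k).cond).modify (transverseStructure p S.ρbar S.jbar) {v} ∅ n).selmerGroup ⊓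
          ((semilinearH S.cd.isLift (S.A k).θ.toAddMonoidHom (S.A k).isSemilinear 1) - AddMonoidHom.id _).ker).map
          (galoisCohomology.localization S.ρbar (Sum.inr v) 1) ≤
          ((hy.h1 k).1.propagateStructure (S.t k).cond) (Sum.inr v) ∨
      ((((hy.h1 k).1.propagateStructure (S.t k).cond).modify (transverseStructure p S.ρbar S.jbar) {v} ∅ n).selmerGroup ⊓
          ((semilinearH S.cd.isLift (S.A k).θ.toAddMonoidHom (S.A k).isSemilinear 1) - AddMonoidHom.id _).ker).map
          (galoisCohomology.localization S.ρbar (Sum.inr v) 1) ≤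
          (transverseStructure p S.ρbar S.jbar) (Sum.inr v))
    (hGDm : ∀ (k : ℕ) (n : Finset (HeightOneSpectrum (𝓞 K))), ↑n ⊆ S.enginePrimes k →
      ∀ v ∈ S.enginePrimes k, v ∉ n →
      letI := (galoisCohomology.moduleH1 (S.ρbar.toLocal (Sum.inr v))
        ((S.isScalarLinear_rhobar hy k).restrictField (Place.Completion (Sum.inr v))));
      Module.length (Rk k) ↥(galoisCohomology.submoduleOfStable
        ((S.isScalarLinear_rhobar hy k).restrictField (Place.Completion (Sum.inr v)))
        (((((hy.h1 k).1.propagateStructure (S.t k).cond).modify (transverseStructure p S.ρbar S.jbar) {v} ∅ n).selmerGroup ⊓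
          ((semilinearH S.cd.isLift (S.A k).θ.toAddMonoidHom (S.A k).isSemilinear 1) + AddMonoidHom.id _).ker).map
          (galoisCohomology.localization S.ρbar (Sum.inr v) 1))
        (scalarMapH1_mem_map_localization S.ρbar (S.isScalarLinear_rhobar hy k) (Sum.inr v)
          (scalarMapH1_mem_inf S.ρbar (S.isScalarLinear_rhobar hy k) (S.scalarMapH1_mem_residualSelmer_modify hy k {v} ∅ n)
          (S.scalarMapH1_mem_kerAdd hy k)))) = 1)
    (horm : ∀ (k : ℕ) (n : Finset (HeightOneSpectrum (𝓞 K))), ↑n ⊆ S.enginePrimes k →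
      ∀ v ∈ S.enginePrimes k, v ∉ n →
      ((((hy.h1 k).1.propagateStructure (S.t k).cond).modify (transverseStructure p S.ρbar S.jbar) {v} ∅ n).selmerGroup ⊓
          ((semilinearH S.cd.isLift (S.A k).θ.toAddMonoidHom (S.A k).isSemilinear 1) + AddMonoidHom.id _).ker).map
          (galoisCohomology.localization S.ρbar (Sum.inr v) 1) ≤
          ((hy.h1 k).1.propagateStructure (S.t k).cond) (Sum.inr v) ∨
      ((((hy.h1 k).1.propagateStructure (S.t k).cond).modify (transverseStructure p S.ρbar S.jbar) {v} ∅ n).selmerGroup ⊓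
          ((semilinearH S.cd.isLift (S.A k).θ.toAddMonoidHom (S.A k).isSemilinear 1) + AddMonoidHom.id _).ker).map
          (galoisCohomology.localization S.ρbar (Sum.inr v) 1) ≤
          (transverseStructure p S.ρbar S.jbar) (Sum.inr v)) :
    ∀ (k : ℕ) (n : Finset (HeightOneSpectrum (𝓞 K))), ↑n ⊆ S.enginePrimes k → 0 < ρp k n → 0 < ρm k n →
      letI := galoisCohomology.moduleH1 (S.T.ρ k) (S.T.hlin k);
      ∀ d : ↥(S.selmerModuleAt hy k n), d ≠ 0 → S.π • d = 0 →
        ∃ ℓ ∈ S.enginePrimes k, ℓ ∉ n ∧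
          (letI := galoisCohomology.moduleH1 ((S.T.ρ k).toLocal (Sum.inr ℓ))
            ((S.T.hlin k).restrictField (Place.Completion (Sum.inr ℓ)));
          (S.locR k (Sum.inr ℓ)).domRestrict (S.selmerModuleAt hy k n) d ≠ 0) ∧
          ρp k (insert ℓ n) + 1 = ρp k n ∧ ρm k (insert ℓ n) + 1 = ρm k n := by
  intro k n hn hposp hposm
  letI := galoisCohomology.moduleH1 (S.T.ρ k) (S.T.hlin k)
  intro d hd0 hπd
  have hd0' : (d : galoisCohomology (S.T.ρ k) 1) ≠ 0 := fun h => hd0 (Subtype.ext h)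
  have hπ' : galoisCohomology.scalarMapH1 (S.T.ρ k) (S.T.hlin k) S.π (d : galoisCohomology (S.T.ρ k) 1) = 0 := by
    have h := congrArg Subtype.val hπd
    rw [Submodule.coe_smul, Submodule.coe_zero] at h
    exact h
  obtain ⟨ℓ, hℓP, hℓn, hloc, hp, hm⟩ := S.exists_enginePrime_caseI hy hC hp0 hL k ρp ρm
    (fun m hm => hρp k m hm) (fun m hm => hρm k m hm) hn (fun v hv _ => hdis k v hv)
    (fun v hv hvn => hGDp k n hn v hv hvn) (fun v hv hvn => horp k n hn v hv hvn)
    (fun v hv hvn => hGDm k n hn v hv hvn) (fun v hv hvn => horm k n hn v hv hvn)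
    hposp hposm ((S.mem_selmerModuleAt_iff hy k n _).1 d.2) hd0' hπ'
  refine ⟨ℓ, hℓP, hℓn, ?_, hp, hm⟩
  letI := galoisCohomology.moduleH1 ((S.T.ρ k).toLocal (Sum.inr ℓ))
    ((S.T.hlin k).restrictField (Place.Completion (Sum.inr ℓ)))
  rw [LinearMap.domRestrict_apply, DVRSetting.locR_apply]
  exact hloc

-- same elaboration cost as `engine_hchebI`.
set_option maxHeartbeats 800000 in
/-- **The engine binder `hchebII` VERBATIM** (same currency and letters as `engine_hchebI`).
[cite: Howard2004HeegnerKolyvagin, Lemma 1.6.4, Case ii (arXiv:1202.6340 p. 12 L15–27)] -/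
theorem engine_hchebII [Finite Nbar] [∀ k, Finite (N k)]
    (S : DVRSetting p K R N Rk Nbar Nq) (hy : S.SatisfiesH) (hC : Automorphic.chebotarev_artinRep)
    (hp0 : ((p : ℕ) : R) ≠ 0) (hL : S.LargePrimes)
    (ρp ρm : ℕ → Finset (HeightOneSpectrum (𝓞 K)) → ℕ)
    (hρp : ∀ (k : ℕ) (n : Finset (HeightOneSpectrum (𝓞 K))), ↑n ⊆ S.enginePrimes k →
      letI := galoisCohomology.moduleH1 S.ρbar (S.isScalarLinear_rhobar hy k);
      ((ρp k n : ℕ) : ℕ∞) = Module.length (Rk k) ↥(galoisCohomology.submoduleOfStable (S.isScalarLinear_rhobar hy k)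
        ((((hy.h1 k).1.propagateStructure (S.t k).cond).modify (transverseStructure p S.ρbar S.jbar) ∅ ∅ n).selmerGroup ⊓
          ((semilinearH S.cd.isLift (S.A k).θ.toAddMonoidHom (S.A k).isSemilinear 1) - AddMonoidHom.id _).ker)
        (scalarMapH1_mem_inf S.ρbar (S.isScalarLinear_rhobar hy k) (S.scalarMapH1_mem_residualSelmer_modify hy k ∅ ∅ n)
          (S.scalarMapH1_mem_kerSub hy k))))
    (hρm : ∀ (k : ℕ) (n : Finset (HeightOneSpectrum (𝓞 K))), ↑n ⊆ S.enginePrimes k →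
      letI := galoisCohomology.moduleH1 S.ρbar (S.isScalarLinear_rhobar hy k);
      ((ρm k n : ℕ) : ℕ∞) = Module.length (Rk k) ↥(galoisCohomology.submoduleOfStable (S.isScalarLinear_rhobar hy k)
        ((((hy.h1 k).1.propagateStructure (S.t k).cond).modify (transverseStructure p S.ρbar S.jbar) ∅ ∅ n).selmerGroup ⊓
          ((semilinearH S.cd.isLift (S.A k).θ.toAddMonoidHom (S.A k).isSemilinear 1) + AddMonoidHom.id _).ker)
        (scalarMapH1_mem_inf S.ρbar (S.isScalarLinear_rhobar hy k) (S.scalarMapH1_mem_residualSelmer_modify hy k ∅ ∅ n)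
          (S.scalarMapH1_mem_kerAdd hy k))))
    (hdis : ∀ (k : ℕ), ∀ v ∈ S.enginePrimes k,
      Disjoint (((hy.h1 k).1.propagateStructure (S.t k).cond) (Sum.inr v))
        ((transverseStructure p S.ρbar S.jbar) (Sum.inr v)))
    (hGDp : ∀ (k : ℕ) (n : Finset (HeightOneSpectrum (𝓞 K))), ↑n ⊆ S.enginePrimes k →
      ∀ v ∈ S.enginePrimes k, v ∉ n →
      letI := (galoisCohomology.moduleH1 (S.ρbar.toLocal (Sum.inr v))
        ((S.isScalarLinear_rhobar hy k).restrictField (Place.Completion (Sum.inr v))));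
      Module.length (Rk k) ↥(galoisCohomology.submoduleOfStable
        ((S.isScalarLinear_rhobar hy k).restrictField (Place.Completion (Sum.inr v)))
        (((((hy.h1 k).1.propagateStructure (S.t k).cond).modify (transverseStructure p S.ρbar S.jbar) {v} ∅ n).selmerGroup ⊓
          ((semilinearH S.cd.isLift (S.A k).θ.toAddMonoidHom (S.A k).isSemilinear 1) - AddMonoidHom.id _).ker).map
          (galoisCohomology.localization S.ρbar (Sum.inr v) 1))
        (scalarMapH1_mem_map_localization S.ρbar (S.isScalarLinear_rhobar hy k) (Sum.inr v)
          (scalarMapH1_mem_inf S.ρbar (S.isScalarLinear_rhobar hy k) (S.scalarMapH1_mem_residualSelmer_modify hy k {v} ∅ n)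
          (S.scalarMapH1_mem_kerSub hy k)))) = 1)
    (horp : ∀ (k : ℕ) (n : Finset (HeightOneSpectrum (𝓞 K))), ↑n ⊆ S.enginePrimes k →
      ∀ v ∈ S.enginePrimes k, v ∉ n →
      ((((hy.h1 k).1.propagateStructure (S.t k).cond).modify (transverseStructure p S.ρbar S.jbar) {v} ∅ n).selmerGroup ⊓
          ((semilinearH S.cd.isLift (S.A k).θ.toAddMonoidHom (S.A k).isSemilinear 1) - AddMonoidHom.id _).ker).map
          (galoisCohomology.localization S.ρbar (Sum.inr v) 1) ≤
          ((hy.h1 k).1.propagateStructure (S.t k).cond) (Sum.inr v) ∨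
      ((((hy.h1 k).1.propagateStructure (S.t k).cond).modify (transverseStructure p S.ρbar S.jbar) {v} ∅ n).selmerGroup ⊓
          ((semilinearH S.cd.isLift (S.A k).θ.toAddMonoidHom (S.A k).isSemilinear 1) - AddMonoidHom.id _).ker).map
          (galoisCohomology.localization S.ρbar (Sum.inr v) 1) ≤
          (transverseStructure p S.ρbar S.jbar) (Sum.inr v))
    (hGDm : ∀ (k : ℕ) (n : Finset (HeightOneSpectrum (𝓞 K))), ↑n ⊆ S.enginePrimes k →
      ∀ v ∈ S.enginePrimes k, v ∉ n →
      letI := (galoisCohomology.moduleH1 (S.ρbar.toLocal (Sum.inr v))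
        ((S.isScalarLinear_rhobar hy k).restrictField (Place.Completion (Sum.inr v))));
      Module.length (Rk k) ↥(galoisCohomology.submoduleOfStable
        ((S.isScalarLinear_rhobar hy k).restrictField (Place.Completion (Sum.inr v)))
        (((((hy.h1 k).1.propagateStructure (S.t k).cond).modify (transverseStructure p S.ρbar S.jbar) {v} ∅ n).selmerGroup ⊓
          ((semilinearH S.cd.isLift (S.A k).θ.toAddMonoidHom (S.A k).isSemilinear 1) + AddMonoidHom.id _).ker).map
          (galoisCohomology.localization S.ρbar (Sum.inr v) 1))
        (scalarMapH1_mem_map_localization S.ρbar (S.isScalarLinear_rhobar hy k) (Sum.inr v)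
          (scalarMapH1_mem_inf S.ρbar (S.isScalarLinear_rhobar hy k) (S.scalarMapH1_mem_residualSelmer_modify hy k {v} ∅ n)
          (S.scalarMapH1_mem_kerAdd hy k)))) = 1)
    (horm : ∀ (k : ℕ) (n : Finset (HeightOneSpectrum (𝓞 K))), ↑n ⊆ S.enginePrimes k →
      ∀ v ∈ S.enginePrimes k, v ∉ n →
      ((((hy.h1 k).1.propagateStructure (S.t k).cond).modify (transverseStructure p S.ρbar S.jbar) {v} ∅ n).selmerGroup ⊓
          ((semilinearH S.cd.isLift (S.A k).θ.toAddMonoidHom (S.A k).isSemilinear 1) + AddMonoidHom.id _).ker).map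
          (galoisCohomology.localization S.ρbar (Sum.inr v) 1) ≤
          ((hy.h1 k).1.propagateStructure (S.t k).cond) (Sum.inr v) ∨
      ((((hy.h1 k).1.propagateStructure (S.t k).cond).modify (transverseStructure p S.ρbar S.jbar) {v} ∅ n).selmerGroup ⊓
          ((semilinearH S.cd.isLift (S.A k).θ.toAddMonoidHom (S.A k).isSemilinear 1) + AddMonoidHom.id _).ker).map
          (galoisCohomology.localization S.ρbar (Sum.inr v) 1) ≤
          (transverseStructure p S.ρbar S.jbar) (Sum.inr v)) :
    ∀ (k : ℕ) (n : Finset (HeightOneSpectrum (𝓞 K))), ↑n ⊆ S.enginePrimes k →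
      (ρm k n = 0 ∧ 2 ≤ ρp k n) ∨ (ρp k n = 0 ∧ 2 ≤ ρm k n) →
      letI := galoisCohomology.moduleH1 (S.T.ρ k) (S.T.hlin k);
      ∀ d : ↥(S.selmerModuleAt hy k n), d ≠ 0 → S.π • d = 0 →
        ∃ ℓ ∈ S.enginePrimes k, ℓ ∉ n ∧
          (letI := galoisCohomology.moduleH1 ((S.T.ρ k).toLocal (Sum.inr ℓ))
            ((S.T.hlin k).restrictField (Place.Completion (Sum.inr ℓ)));
          (S.locR k (Sum.inr ℓ)).domRestrict (S.selmerModuleAt hy k n) d ≠ 0) ∧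
          0 < ρp k (insert ℓ n) ∧ 0 < ρm k (insert ℓ n) ∧
          ρp k (insert ℓ n) + ρm k (insert ℓ n) = ρp k n + ρm k n := by
  intro k n hn hcase
  letI := galoisCohomology.moduleH1 (S.T.ρ k) (S.T.hlin k)
  intro d hd0 hπd
  have hd0' : (d : galoisCohomology (S.T.ρ k) 1) ≠ 0 := fun h => hd0 (Subtype.ext h)
  have hπ' : galoisCohomology.scalarMapH1 (S.T.ρ k) (S.T.hlin k) S.π (d : galoisCohomology (S.T.ρ k) 1) = 0 := by
    have h := congrArg Subtype.val hπd
    rw [Submodule.coe_smul, Submodule.coe_zero] at h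
    exact h
  obtain ⟨ℓ, hℓP, hℓn, hloc, hp, hm, hsum⟩ := S.exists_enginePrime_caseII hy hC hp0 hL k ρp ρm
    (fun m hm => hρp k m hm) (fun m hm => hρm k m hm) hn (fun v hv _ => hdis k v hv)
    (fun v hv hvn => hGDp k n hn v hv hvn) (fun v hv hvn => horp k n hn v hv hvn)
    (fun v hv hvn => hGDm k n hn v hv hvn) (fun v hv hvn => horm k n hn v hv hvn)
    hcase ((S.mem_selmerModuleAt_iff hy k n _).1 d.2) hd0' hπ'
  refine ⟨ℓ, hℓP, hℓn, ?_, hp, hm, hsum⟩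
  letI := galoisCohomology.moduleH1 ((S.T.ρ k).toLocal (Sum.inr ℓ))
    ((S.T.hlin k).restrictField (Place.Completion (Sum.inr ℓ)))
  rw [LinearMap.domRestrict_apply, DVRSetting.locR_apply]
  exact hloc

end DVRSetting

end Literature.NumberTheory.GaloisCohomology.Howard2004

end
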